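import Summits.ResolutionOfSingularities.ResolutionOfSingularities.Theorems.FrobeniusLadderFInjectiveMacaulayficationG1CornerGradedData
import Summits.ResolutionOfSingularities.ResolutionOfSingularities.Theorems.FrobeniusLadderFInjectiveMacaulayficationG1CornerVeroneseSplitting
import Summits.ResolutionOfSingularities.ResolutionOfSingularities.Theorems.FrobeniusLadderFInjectiveMacaulayficationGradedEngineOfChartClause
import HarnessLib

/-!
# The corner-G1 specimen in ONE weighted blow-up at every odd prime, modulo the graded engine (calibration G6d)

[OURS · L1 W4.5a] Support file for crux stmt-ResolutionOfSingularities-15315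
(`Summit.ResolutionOfSingularities.ResolutionOfSingularities.Theses.FrobeniusLadder.FInjectiveMacaulayfication`, route
`FrobeniusLadder`, skeleton v11 `86e9127b5c98b8e6`, line `graded-engine`).  Calibration G6d of CHAIN w45a v3.8 (tri-1 TRIAGE §10,
the CORNER-G1 specimen `g = X₂² + X₀³X₁² + X₁³`, singular along a line, not normal at the origin; tri-1 by hand: the point
blow-up fails at every odd `p`, the `(2,6,9)`-weighted point centre works at `p = 3, 5, 7`): **modulo the registered graded
engine G5 `stub_gradedConeFiModel` (equivalently modulo G4 `stub_gradedChartClause`, via `GradedEngineOfChartClause`), at EVERY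
ODD prime the single `(2,6,9)`-weighted blow-up `affineBlowup I₁₈` (`N = 18`, `c = (9,3,2)`) is an F-injective Macaulayfication
of `Spec k[X₀,X₁,X₂]/(g)`** — inputs: Veronese splitting `G1CornerVeroneseSplitting.g1CornerVeroneseSplitting`, homogeneity /
primality / `x̄ⱼ ≠ 0` / the off-origin clause at odd `p` from `G1CornerGradedData`.  So "corner G1 ∩ graded is INSIDE the graded
engine" (CHAIN v3.8) is kernel-checked modulo G4, for all odd `p` at once.  No definition is declared; AI-written, weaker than
expert review; no statement of [claim: Hironaka2017] is used. [folklore]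
-/

-- single-problem summit: the doubled namespace component is forced
set_option linter.dupNamespace false

noncomputable section

open CategoryTheory AlgebraicGeometry MvPolynomial
open Literature.AlgebraicGeometry.Resolution
open Summit.ResolutionOfSingularities.ResolutionOfSingularities.Theorems.FInjectiveMacaulayfication

namespace Summit.ResolutionOfSingularities.ResolutionOfSingularities.Theorems.FInjectiveMacaulayfication.G1CornerGradedFiModel

/-- **G6d modulo G5**: if the graded engine G5 holds (registered signature of `stub_gradedConeFiModel` verbatim), then over
every field of ODD characteristic `p` the surface `X₂² + X₀³X₁² + X₁³ = 0` admits the crux's model by the single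
`(2,6,9)`-weighted blow-up `affineBlowup I₁₈` (`N = 18`, `c = (9,3,2)`). [folklore] -/
theorem g1CornerGradedFiModel_of_gradedEngine
    (hG5 : ∀ (p : ℕ) [Fact p.Prime] (k : Type) [Field k] [CharP k p] (n : ℕ) (w : Fin n → ℕ) (N D : ℕ) (c : Fin n → ℕ), 0 < N → (∀ v : Fin n, 0 < w v ∧ c v * w v = N) → (∀ (K : ℕ) (b : Fin n →₀ ℕ), K * N ≤ Finsupp.weight w b → (MvPolynomial.monomial b (1 : k) : MvPolynomial (Fin n) k) ∈ (Ideal.span {m : MvPolynomial (Fin n) k | ∃ b : Fin n →₀ ℕ, N ≤ Finsupp.weight w b ∧ m = MvPolynomial.monomial b 1}) ^ K) → ∀ (f : MvPolynomial (Fin n) k), MvPolynomial.IsWeightedHomogeneous w f D → (Ideal.span {f}).IsPrime → (∀ v : Fin n, Ideal.Quotient.mk (Ideal.span {f}) (MvPolynomial.X v) ≠ 0) → (∀ (Q : Ideal (MvPolynomial (Fin n) k ⧸ Ideal.span {f})) [Q.IsMaximal], (∃ j : Fin n, Ideal.Quotient.mk (Ideal.span {f}) (MvPolynomial.X j) ∉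 Q) → ∀ d : ℕ, ringKrullDim (Localization.AtPrime Q) = d → ∀ s : Fin d → Localization.AtPrime Q, (Ideal.span (Set.range s)).radical.IsMaximal → RingTheory.Sequence.IsWeaklyRegular (Localization.AtPrime Q) (List.ofFn s) ∧ ∀ y : Localization.AtPrime Q, (∃ e : ℕ, y ^ p ^ e ∈ Ideal.span ((fun z : Localization.AtPrime Q => z ^ p ^ e) '' (Ideal.span (Set.range s) : Set (Localization.AtPrime Q)))) → y ∈ Ideal.span (Set.range s)) → ∃ (X' : Scheme.{0}) (π : X' ⟶ Spec (.of (MvPolynomial (Fin n) k ⧸ Ideal.span {f}))), IsProper π ∧ Literature.AlgebraicGeometry.Resolution.IsBirational π ∧ ∀ y : X', IsDomain (X'.presheaf.stalk y) ∧ ∀ d : ℕ, ringKrullDim (X'.presheaf.stalk y) = d → ∀ s : Fin d → X'.presheaf.stalk y, (Ideal.span (Set.range s)).radical.IsMaximal → RingTheory.Sequence.IsWeaklyRegular (X'.presheaf.stalk y) (List.ofFn s) ∧ ∀ z : X'.presheaf.stalk y, (∃ e : ℕ, z ^ p ^ e ∈ Ideal.span ((fun w : X'.presheaf.stalk y =>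 w ^ p ^ e) '' (Ideal.span (Set.range s) : Set (X'.presheaf.stalk y)))) → z ∈ Ideal.span (Set.range s)) :
    ∀ (p : ℕ) [Fact p.Prime], p ≠ 2 → ∀ (k : Type) [Field k] [CharP k p] (f : MvPolynomial (Fin 3) k),
    f = MvPolynomial.X 2 ^ 2 + MvPolynomial.X 0 ^ 3 * MvPolynomial.X 1 ^ 2 + MvPolynomial.X 1 ^ 3 →
    ∃ (X' : Scheme.{0}) (π : X' ⟶ Spec (.of (MvPolynomial (Fin 3) k ⧸ Ideal.span {f}))), IsProper π ∧
      Literature.AlgebraicGeometry.Resolution.IsBirational π ∧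
      ∀ y : X', IsDomain (X'.presheaf.stalk y) ∧ ∀ d : ℕ, ringKrullDim (X'.presheaf.stalk y) = d →
        ∀ s : Fin d → X'.presheaf.stalk y, (Ideal.span (Set.range s)).radical.IsMaximal →
          RingTheory.Sequence.IsWeaklyRegular (X'.presheaf.stalk y) (List.ofFn s) ∧
          ∀ z : X'.presheaf.stalk y, (∃ e : ℕ, z ^ p ^ e ∈
              Ideal.span ((fun w : X'.presheaf.stalk y => w ^ p ^ e) ''
                (Ideal.span (Set.range s) : Set (X'.presheaf.stalk y)))) →
            z ∈ Ideal.span (Set.range s) := by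
  intro p _ hp2 k _ _ f hf
  refine hG5 p k 3 ![2, 6, 9] 18 18 ![9, 3, 2] (by norm_num) (by decide)
    (G1CornerVeroneseSplitting.g1CornerVeroneseSplitting k) f ?_ (G1CornerGradedData.isPrime_span_g k f hf)
    (G1CornerGradedData.g_X_ne_zero k f hf) (G1CornerGradedData.g1Corner_offOrigin_clause p hp2 k f hf)
  rw [hf]
  exact G1CornerGradedData.g1_isWeightedHomogeneous k

/-- **G6d modulo G4**: the same conclusion from the graded chart clause G4 (registered signature of
`stub_gradedChartClause` verbatim), through `GradedEngineOfChartClause.gradedConeFiModel_of_gradedChartClause`. [folklore] -/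
theorem g1CornerGradedFiModel_of_gradedChartClause
    (hG4 : ∀ (p : ℕ) [Fact p.Prime] (k : Type) [Field k] [CharP k p] (n : ℕ) (w : Fin n → ℕ) (v : Fin n), 0 < w v → ∀ (N c D : ℕ), c * w v = N → 0 < c → (∀ (K : ℕ) (b : Fin n →₀ ℕ), K * N ≤ Finsupp.weight w b → (MvPolynomial.monomial b (1 : k) : MvPolynomial (Fin n) k) ∈ (Ideal.span {m : MvPolynomial (Fin n) k | ∃ b : Fin n →₀ ℕ, N ≤ Finsupp.weight w b ∧ m = MvPolynomial.monomial b 1}) ^ K) → ∀ (f : MvPolynomial (Fin n) k), MvPolynomial.IsWeightedHomogeneous w f D → (Ideal.span {f}).IsPrime → (∀ j : Fin n, Ideal.Quotient.mk (Ideal.span {f}) (MvPolynomial.X j) ≠ 0) → (∀ (Q : Ideal (MvPolynomial (Fin n) k ⧸ Ideal.span {f})) [Q.IsMaximal], (∃ j : Fin n, Ideal.Quotient.mk (Ideal.span {f}) (MvPolynomial.X j) ∉ Q) → ∀ d : ℕ, ringKrullDim (Localization.AtPrime Q) = d → ∀ s : Fin d → Localization.AtPrime Q, (Ideal.span (Set.range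 s)).radical.IsMaximal → RingTheory.Sequence.IsWeaklyRegular (Localization.AtPrime Q) (List.ofFn s) ∧ ∀ y : Localization.AtPrime Q, (∃ e : ℕ, y ^ p ^ e ∈ Ideal.span ((fun z : Localization.AtPrime Q => z ^ p ^ e) '' (Ideal.span (Set.range s) : Set (Localization.AtPrime Q)))) → y ∈ Ideal.span (Set.range s)) → ∀ (Q : Ideal (blowupAlgebra ((Ideal.span {m : MvPolynomial (Fin n) k | ∃ b : Fin n →₀ ℕ, N ≤ Finsupp.weight w b ∧ m = MvPolynomial.monomial b 1}).map (Ideal.Quotient.mk (Ideal.span {f}))) (Ideal.Quotient.mk (Ideal.span {f}) (MvPolynomial.X v) ^ c))) [Q.IsMaximal], algebraMap (MvPolynomial (Fin n) k ⧸ Ideal.span {f}) (blowupAlgebra ((Ideal.span {m : MvPolynomial (Fin n) k | ∃ b : Fin n →₀ ℕ, N ≤ Finsupp.weight w b ∧ m = MvPolynomial.monomial b 1}).map (Ideal.Quotient.mk (Ideal.span {f}))) (Ideal.Quotient.mk (Ideal.span {f}) (MvPolynomial.X v) ^ c)) (Ideal.Quotient.mk (Ideal.span {f}) (MvPolynomial.X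 v) ^ c) ∈ Q → ∀ d : ℕ, ringKrullDim (Localization.AtPrime Q) = d → ∀ s : Fin d → Localization.AtPrime Q, (Ideal.span (Set.range s)).radical.IsMaximal → RingTheory.Sequence.IsWeaklyRegular (Localization.AtPrime Q) (List.ofFn s) ∧ ∀ y : Localization.AtPrime Q, (∃ e : ℕ, y ^ p ^ e ∈ Ideal.span ((fun z : Localization.AtPrime Q => z ^ p ^ e) '' (Ideal.span (Set.range s) : Set (Localization.AtPrime Q)))) → y ∈ Ideal.span (Set.range s)) :
    ∀ (p : ℕ) [Fact p.Prime], p ≠ 2 → ∀ (k : Type) [Field k] [CharP k p] (f : MvPolynomial (Fin 3) k),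
    f = MvPolynomial.X 2 ^ 2 + MvPolynomial.X 0 ^ 3 * MvPolynomial.X 1 ^ 2 + MvPolynomial.X 1 ^ 3 →
    ∃ (X' : Scheme.{0}) (π : X' ⟶ Spec (.of (MvPolynomial (Fin 3) k ⧸ Ideal.span {f}))), IsProper π ∧
      Literature.AlgebraicGeometry.Resolution.IsBirational π ∧
      ∀ y : X', IsDomain (X'.presheaf.stalk y) ∧ ∀ d : ℕ, ringKrullDim (X'.presheaf.stalk y) = d →
        ∀ s : Fin d → X'.presheaf.stalk y, (Ideal.span (Set.range s)).radical.IsMaximal →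
          RingTheory.Sequence.IsWeaklyRegular (X'.presheaf.stalk y) (List.ofFn s) ∧
          ∀ z : X'.presheaf.stalk y, (∃ e : ℕ, z ^ p ^ e ∈
              Ideal.span ((fun w : X'.presheaf.stalk y => w ^ p ^ e) ''
                (Ideal.span (Set.range s) : Set (X'.presheaf.stalk y)))) →
            z ∈ Ideal.span (Set.range s) :=
  g1CornerGradedFiModel_of_gradedEngine (GradedEngineOfChartClause.gradedConeFiModel_of_gradedChartClause hG4)

end Summit.ResolutionOfSingularities.ResolutionOfSingularities.Theorems.FInjectiveMacaulayfication.G1CornerGradedFiModel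

end
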